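/-
Copyright (c) 2026 the pub-hodgecm-mathlib formalisation cell (harness21).  Prover seat hodgecm-mathlib-LH1-p01 (g12) on the N8-INNER road (row 2 `stub_N8`, ROAD B
«EP road», road owner LH2-plan (g1)), brick (8) «WALL EP GENERATOR», part (8b): Harish-Chandra's slice generator — a test function fibred over the centraliser slice; 2026-09-02.
-/
import Literature.NumberTheory.Automorphic.UnitarySliceChartSmooth       -- (this seat) ★ p852054 (8a): `exists_cayleySliceChart_unitary_contDiffOn` (the smooth slice chart at a semisimple point)
import Mathlib.Analysis.Calculus.BumpFunction.FiniteDimension            -- Mathlib: `ContDiffBump` on finite-dimensional real normed spaces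
import HarnessLib

/-!
# The SLICE GENERATOR at a semisimple point of a complex unitary group: a `C_c^∞` function fibred over Harish-Chandra's slice, `f(c(X)·ζ·c(X)⁻¹) = a(X)·Φ(ζ)`,
# and its orbital FIBRATION IDENTITY along the centraliser orbits of slice points (Varadarajan 1977 Part I §2; Bouaziz 1994 §2; Rogawski 1990 §8.2 Prop. 8.2.1)

Topic `NumberTheory/Automorphic`; namespace `Literature.NumberTheory.Automorphic`.  THEOREMS ONLY (no definition, no instance, no notation, no axiom, no named fact, no `sorry`);
kernel lane `--kind proof --supports stmt-HodgeConjecture-24833`.  Cell `pub/hodgecm-mathlib`, crux H413 = `stmt-HodgeConjecture-24833`; N8-INNER ROAD B (road owner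
LH2-plan (g1) 2026-09-02T16:08:52Z ∕ 16:17:17Z), brick **(8) «WALL EP GENERATOR (one place)»**, binder LH1-p01 (g12), part **(8b) THE GENERATOR + ITS FIBRATION PROPERTY**
(SIGSHEET v1.2 `F0/P3c/LH1/LH1-p01/g12/brick8/SIGSHEET-8-wallEP.v1_2.LH1p01g12.md` 155410b5e8b92726).  Author LH1-p01 (g12).

THE MATHEMATICS (Harish-Chandra's descent, run BACKWARDS).  `γ ∈ U = U(σ, J) ≤ GL_n(ℂ)` semisimple (annihilated by a separable polynomial), `Z = Z_U(γ)`, and WEYL SEPARATION at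
`γ` as a hypothesis `hW` (near `(γ, γ)`, an intertwiner of two elements of the commutant is in the commutant — ★ `BlockCentralizerNearScalar.eventually_commute_of_mul_eq_of_frame`
supplies it at `γ = a·1 ⊕ u·1`, `a ≠ u`, e.g. a semiregular wall point of `U(2,1)`).  The smooth slice chart `e(X, Y) = c(X)·γc(Y)·c(X)⁻¹` (★ (8a)) identifies a neighbourhood
of `γ` with (transversal `X ∈ 𝔲 ∩ 𝔪`) × (slice point `γ c(Y) ∈ Z`).  Given ANY ambient `C^∞` function `Φ` whose restriction to `Z` is supported in a small slice neighbourhood `V₀` of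
`γ` (the BLOCK GENERATOR: for brick (8), the rank-one compact-type wall generator of ★ (W3-G) on `Z ≅ U(1,1) × U(1)`), the SLICE GENERATOR is
  `f := 𝟙_u · (a ∘ pr₁ ∘ e⁻¹) · (b₂ ∘ pr₂ ∘ e⁻¹) · (Φ ∘ e ∘ (0, pr₂ ∘ e⁻¹))`  — in words `f(c(X) · γc(Y) · c(X)⁻¹) = a(X) · b₂(Y) · Φ(γ c(Y))`,
`a`, `b₂` bump functions on `𝔪`, `𝔠` (`a(0) = 1`, `b₂ ≡ 1` where `Φ|_Z` lives).  It is `C^∞` on `M_n(ℂ)`, supported in any prescribed neighbourhood `U₀` of `γ`, and — THE POINT —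
its values along every `U`-conjugate of every `Z`-conjugate of every slice point `γ′ ∈ Z ∩ V₀` FACTOR:
  **`f(x · ℓγ′ℓ⁻¹ · x⁻¹) = g(xγx⁻¹) · Φ(w · ℓγ′ℓ⁻¹ · w⁻¹)`  for all `x ∈ U`, `ℓ ∈ Z`, with ONE `w = w(x) ∈ Z`**  (`g = 𝟙_u·(a∘pr₁∘e⁻¹)·(b₂∘pr₂∘e⁻¹) ∈ C_c`, `g(γ) = 1`),
because `x·ℓγ′ℓ⁻¹·x⁻¹ ∈ supp f` forces `x ∈ c(X)·Z` (Weyl separation (SEP′): a conjugator between two slice points lies in `Z`), `X` unique (injectivity of `e`), `w := c(X)⁻¹x`.  The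
identity is stated along `Z`-ORBITS OF SLICE POINTS only — for arbitrary `η ∈ Z` it is false (`Z` contains `U`-conjugates of slice points by non-`Z` conjugators).  Integrating in
stages `U⧸T → U⧸Z → Z⧸T` (★ `InvariantQuotientChainRuleBochner`, brick (8c)) then gives `∫_{U⧸T} f(xγ′x⁻¹) = c · (∫_{U⧸Z} g(xγx⁻¹)) · ∫_{Z⧸T} Φ(zγ′z⁻¹)`: the orbital integrals of `f`
near `γ` ARE those of the block generator.  No measure theory in this file.
* §1 two smoothness helpers: `contDiff_mul_of_tsupport_subset` (cut-off × `ContDiffOn`), `contDiff_indicator_of_forall_mem` (`𝟙_u · H` when `H|_u` is supported in a closed `C ⊆ u`).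
* §2 HEAD **`exists_sliceGenerator`**.
HONEST LABEL: HC_CM is proved only modulo the 7 printed citations (2 remaining: hLiu418 = `stmt-HodgeConjecture-24832`, h413 = `stmt-HodgeConjecture-24833`) until rung 0 closes;
count-neutral (differential topology of matrices; pays nothing by itself).

## References
* [Varadarajan1977] V. S. Varadarajan, *Harmonic Analysis on Real Reductive Groups*, LNM 576 (1977), Part I §2 (descent to `Z_G(γ)`: the submersion and the map `f ↦ f_M`).
* [Bouaziz1994IntegralesOrbitales] A. Bouaziz, *Intégrales orbitales sur les groupes de Lie réductifs*, Ann. Sci. ÉNS (4) 27 (1994), §2.3 p. 578, §3.2 p. 580 (descente de Harish-Chandra).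
* [Rogawski1990] J. D. Rogawski, *Automorphic Representations of Unitary Groups in Three Variables*, Ann. of Math. Stud. 123 (1990), §8.2 Prop. 8.2.1 pp. 112–116, §4.12 Lemma 4.12.1 p. 61.
* [HarishChandra1970] Harish-Chandra (notes by G. van Dijk), *Harmonic Analysis on Reductive p-adic Groups*, LNM 162 (1970), Part II §5 (descent at a semisimple point).
-/

set_option autoImplicit false

noncomputable section

open Filter Topology Set Metric
open scoped Matrix.Norms.Operator Matrix ContDiff

namespace Literature.NumberTheory.Automorphic

open Literature.Analysis.Calculus Literature.LinearAlgebra.Matrix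

/-! ## §1 Two smoothness helpers -/

section Helpers

variable {E : Type*} [NormedAddCommGroup E] [NormedSpace ℝ E]

/-- A `C^n` function supported inside an open set times a function `C^n` on that open set is `C^n` everywhere. [cite: Varadarajan1977, Part I §2] -/
theorem contDiff_mul_of_tsupport_subset {n : WithTop ℕ∞} {g h : E → ℂ} {O : Set E} (hO : IsOpen O) (hg : ContDiff ℝ n g) (hsupp : tsupport g ⊆ O)
    (hh : ContDiffOn ℝ n h O) : ContDiff ℝ n fun x => g x * h x := by
  refine contDiff_iff_contDiffAt.2 fun x => ?_
  by_cases hx : x ∈ O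
  · exact hg.contDiffAt.mul (hh.contDiffAt (hO.mem_nhds hx))
  · have hx' : x ∉ tsupport g := fun h' => hx (hsupp h')
    have hev : (fun y => g y * h y) =ᶠ[𝓝 x] fun _ => 0 := by
      filter_upwards [notMem_tsupport_iff_eventuallyEq.1 hx'] with y hy
      rw [hy, Pi.zero_apply, zero_mul]
    exact contDiffAt_const.congr_of_eventuallyEq hev

/-- `𝟙_u · H` is `C^n` when `H` is `C^n` on the open `u` and vanishes on `u` off a closed `C ⊆ u`; and it vanishes off `C`. [cite: Varadarajan1977, Part I §2] -/
theorem contDiff_indicator_of_forall_mem {n : WithTop ℕ∞} {H : E → ℂ} {u C : Set E} (hu : IsOpen u) (hH : ContDiffOn ℝ n H u)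
    (hC : IsClosed C) (hCu : C ⊆ u) (hHC : ∀ x ∈ u, H x ≠ 0 → x ∈ C) :
    ContDiff ℝ n (u.indicator H) ∧ ∀ x, u.indicator H x ≠ 0 → x ∈ C := by
  have hzero : ∀ x, u.indicator H x ≠ 0 → x ∈ C := by
    intro x hx
    by_cases hxu : x ∈ u
    · rw [Set.indicator_of_mem hxu] at hx; exact hHC x hxu hx
    · rw [Set.indicator_of_notMem hxu] at hx; exact absurd rfl hx
  refine ⟨contDiff_iff_contDiffAt.2 fun x => ?_, hzero⟩
  by_cases hxu : x ∈ u
  · have hev : u.indicator H =ᶠ[𝓝 x] H := by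
      filter_upwards [hu.mem_nhds hxu] with y hy
      rw [Set.indicator_of_mem hy]
    exact (hH.contDiffAt (hu.mem_nhds hxu)).congr_of_eventuallyEq hev
  · have hxC : x ∉ C := fun h => hxu (hCu h)
    have hev : u.indicator H =ᶠ[𝓝 x] fun _ => 0 := by
      filter_upwards [hC.isOpen_compl.mem_nhds hxC] with y hy
      by_contra h
      exact hy (hzero y h)
    exact contDiffAt_const.congr_of_eventuallyEq hev

end Helpers

/-! ## §2 The slice generator -/

section Generator

variable {n : Type*} [Fintype n] [DecidableEq n]

set_option maxHeartbeats 400000 in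
/-- **THE SLICE GENERATOR AND ITS FIBRATION IDENTITY.**  `σ : ℂ →+* ℂ` continuous, `J` with unit determinant, `γ ∈ U = U(σ, J)` annihilated by a separable polynomial, `Z = Z_U(γ)` (as
`Subgroup.centralizer {γ}`), and WEYL SEPARATION at `γ` (`hW`: near `(γ, γ)`, `y q₁ = q₂ y` with `q₁, q₂` in the commutant forces `y` into the commutant).  For every neighbourhood
`U₀` of `γ` there are a neighbourhood `V₀` of `γ` and, for every ambient `C^∞` function `Φ` whose restriction to `Z` is supported in `V₀`, functions `f` (the SLICE GENERATOR:
`C^∞`, compactly supported in `U₀`) and `g` (`C^∞`, compactly supported, real `≥ 0`, `g(γ) = 1`) such that, for every slice point `γ′ ∈ Z ∩ V₀` and every `x ∈ U`, ONE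
`w ∈ Z` gives `f(x · ℓγ′ℓ⁻¹ · x⁻¹) = g(xγx⁻¹) · Φ(w · ℓγ′ℓ⁻¹ · w⁻¹)` for ALL `ℓ ∈ Z` — the hypothesis `hfib` of brick (8c)'s stages formula with `Ā x := g(xγx⁻¹)`.
[cite: Varadarajan1977, Part I §2] [cite: Bouaziz1994IntegralesOrbitales, §2.3 p. 578] [cite: HarishChandra1970, Part II §5] [cite: Rogawski1990, §8.2 Prop. 8.2.1 pp. 112–116] -/
theorem exists_sliceGenerator (σ : ℂ →+* ℂ) (hσ : Continuous σ) {J : Matrix n n ℂ} (hJ : IsUnit J.det)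
    (γ : GL n ℂ) (hγU : γ ∈ unitaryGroupOfForm σ J) {p : Polynomial ℂ} (hp : p.Separable) (hγ : Polynomial.aeval (γ : Matrix n n ℂ) p = 0)
    (hW : ∀ᶠ q : Matrix n n ℂ × Matrix n n ℂ in 𝓝 ((γ : Matrix n n ℂ), (γ : Matrix n n ℂ)),
      Commute q.1 (γ : Matrix n n ℂ) → Commute q.2 (γ : Matrix n n ℂ) → ∀ y : Matrix n n ℂ, y * q.1 = q.2 * y → Commute y (γ : Matrix n n ℂ))
    (U₀ : Set (Matrix n n ℂ)) (hU₀ : U₀ ∈ 𝓝 (γ : Matrix n n ℂ)) :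
    ∃ V₀ : Set (Matrix n n ℂ), V₀ ∈ 𝓝 (γ : Matrix n n ℂ) ∧
      ∀ Φ : Matrix n n ℂ → ℂ, ContDiff ℝ ∞ Φ →
        (∀ z : ↥(unitaryGroupOfForm σ J), z ∈ Subgroup.centralizer ({⟨γ, hγU⟩} : Set ↥(unitaryGroupOfForm σ J)) →
          Φ ((z : GL n ℂ) : Matrix n n ℂ) ≠ 0 → ((z : GL n ℂ) : Matrix n n ℂ) ∈ V₀) →
        ∃ (f g : Matrix n n ℂ → ℂ),
          ContDiff ℝ ∞ f ∧ HasCompactSupport f ∧ tsupport f ⊆ U₀ ∧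
          ContDiff ℝ ∞ g ∧ HasCompactSupport g ∧ tsupport g ⊆ U₀ ∧ (∀ W, 0 ≤ (g W).re ∧ (g W).im = 0) ∧ g (γ : Matrix n n ℂ) = 1 ∧
          ∀ γ' : ↥(unitaryGroupOfForm σ J), γ' ∈ Subgroup.centralizer ({⟨γ, hγU⟩} : Set ↥(unitaryGroupOfForm σ J)) →
            ((γ' : GL n ℂ) : Matrix n n ℂ) ∈ V₀ →
            ∀ x : ↥(unitaryGroupOfForm σ J), ∃ w : ↥(unitaryGroupOfForm σ J),
              w ∈ Subgroup.centralizer ({⟨γ, hγU⟩} : Set ↥(unitaryGroupOfForm σ J)) ∧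
              ∀ ℓ : ↥(unitaryGroupOfForm σ J), ℓ ∈ Subgroup.centralizer ({⟨γ, hγU⟩} : Set ↥(unitaryGroupOfForm σ J)) →
                f (((x * (ℓ * γ' * ℓ⁻¹) * x⁻¹ : ↥(unitaryGroupOfForm σ J)) : GL n ℂ) : Matrix n n ℂ) =
                  g (((x * ⟨γ, hγU⟩ * x⁻¹ : ↥(unitaryGroupOfForm σ J)) : GL n ℂ) : Matrix n n ℂ) *
                    Φ (((w * (ℓ * γ' * ℓ⁻¹) * w⁻¹ : ↥(unitaryGroupOfForm σ J)) : GL n ℂ) : Matrix n n ℂ) := by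
  classical
  -- ### §0 notation, instances, the centraliser
  haveI : @CompleteSpace (Matrix n n ℂ) PseudoMetricSpace.toUniformSpace := FiniteDimensional.complete ℂ (Matrix n n ℂ)
  set A : Matrix n n ℂ := (γ : Matrix n n ℂ) with hAdef
  set ad : Module.End ℂ (Matrix n n ℂ) := LinearMap.mulLeft ℂ A - LinearMap.mulRight ℂ A with had
  set U : Subgroup (GL n ℂ) := unitaryGroupOfForm σ J with hUdef
  set γU : ↥U := ⟨γ, hγU⟩ with hγUdef
  set Z : Subgroup ↥U := Subgroup.centralizer ({γU} : Set ↥U) with hZdef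
  haveI : ProperSpace ↥(LinearMap.range ad) := FiniteDimensional.proper ℂ _
  haveI : ProperSpace ↥(LinearMap.ker ad) := FiniteDimensional.proper ℂ _
  have hcK := Literature.LinearAlgebra.Matrix.isCompl_ker_range_mulLeft_sub_mulRight_of_separable_aeval_eq_zero A hp hγ
  rw [← had] at hcK
  have had_apply : ∀ X : Matrix n n ℂ, ad X = A * X - X * A := fun X => by
    rw [had, LinearMap.sub_apply, LinearMap.mulLeft_apply, LinearMap.mulRight_apply]
  -- coercion bookkeeping `↥U → M`
  have cm : ∀ s t : ↥U, (((s * t : ↥U) : GL n ℂ) : Matrix n n ℂ) = ((s : GL n ℂ) : Matrix n n ℂ) * ((t : GL n ℂ) : Matrix n n ℂ) :=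
    fun _ _ => rfl
  have cinv : ∀ t : ↥U, (((t⁻¹ : ↥U) : GL n ℂ) : Matrix n n ℂ) = Ring.inverse ((t : GL n ℂ) : Matrix n n ℂ) :=
    fun t => (Ring.inverse_unit (t : GL n ℂ)).symm
  have cim : ∀ t : ↥U, (((t⁻¹ : ↥U) : GL n ℂ) : Matrix n n ℂ) * ((t : GL n ℂ) : Matrix n n ℂ) = 1 := fun t => Units.inv_mul _
  have cmi : ∀ t : ↥U, ((t : GL n ℂ) : Matrix n n ℂ) * (((t⁻¹ : ↥U) : GL n ℂ) : Matrix n n ℂ) = 1 := fun t => Units.mul_inv _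
  have hγUA : ((γU : GL n ℂ) : Matrix n n ℂ) = A := rfl
  have hZ : ∀ z : ↥U, z ∈ Z ↔ Commute ((z : GL n ℂ) : Matrix n n ℂ) A := by
    intro z
    rw [hZdef, Subgroup.mem_centralizer_iff]
    simp only [Set.mem_singleton_iff, forall_eq]
    constructor
    · intro h
      have h' := congrArg (fun t : ↥U => ((t : GL n ℂ) : Matrix n n ℂ)) h
      simp only [cm, hγUA] at h'
      exact h'.symm
    · intro h
      apply Subtype.ext; apply Units.ext
      show ((γU : GL n ℂ) : Matrix n n ℂ) * ((z : GL n ℂ) : Matrix n n ℂ) = ((z : GL n ℂ) : Matrix n n ℂ) * ((γU : GL n ℂ) : Matrix n n ℂ)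
      rw [hγUA]; exact h.eq.symm
  have hγUZ : γU ∈ Z := (hZ γU).2 (Commute.refl A)
  -- ### §1 the smooth slice chart (★ (8a))
  obtain ⟨e, h0, hγt, he, hunits, hI, hsymm, u, huo, hγu, hut, hsm⟩ :=
    exists_cayleySliceChart_unitary_contDiffOn σ hσ hJ γ hγU hp hγ
  replace he : ∀ q : ↥(LinearMap.range ad) × ↥(LinearMap.ker ad),
      e q = cayley (q.1 : Matrix n n ℂ) * (A * cayley (q.2 : Matrix n n ℂ)) * Ring.inverse (cayley (q.1 : Matrix n n ℂ)) := he
  have hF : (e : ↥(LinearMap.range ad) × ↥(LinearMap.ker ad) → Matrix n n ℂ) = fun q =>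
      cayley (q.1 : Matrix n n ℂ) * (A * cayley (q.2 : Matrix n n ℂ)) * Ring.inverse (cayley (q.1 : Matrix n n ℂ)) := funext he
  have he0 : e 0 = A := by rw [← hsymm]; exact e.right_inv hγt
  -- ### §2 the Weyl-separation neighbourhood `V` of `A`
  obtain ⟨V₁, hV₁, V₂, hV₂, hV₁₂⟩ := mem_nhds_prod_iff.1 hW
  set V : Set (Matrix n n ℂ) := interior (V₁ ∩ V₂) with hVdef
  have hVo : IsOpen V := isOpen_interior
  have hAV : A ∈ V := mem_interior_iff_mem_nhds.2 (Filter.inter_mem hV₁ hV₂)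
  have hVW : ∀ q₁ ∈ V, ∀ q₂ ∈ V, Commute q₁ A → Commute q₂ A → ∀ y : Matrix n n ℂ, y * q₁ = q₂ * y → Commute y A := by
    intro q₁ hq₁ q₂ hq₂ h₁ h₂ y hy
    exact hV₁₂ (Set.mk_mem_prod (interior_subset hq₁).1 (interior_subset hq₂).2) h₁ h₂ y hy
  -- ### §3 the box radius `r`: `closedBall 0 r ⊆ e.source ∩ e⁻¹(u ∩ U₀° ∩ V)`
  set O : Set (Matrix n n ℂ) := u ∩ interior U₀ ∩ V with hOdef
  have hOo : IsOpen O := (huo.inter isOpen_interior).inter hVo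
  have hAO : A ∈ O := ⟨⟨hγu, mem_interior_iff_mem_nhds.2 hU₀⟩, hAV⟩
  have hSo : IsOpen (e.source ∩ e ⁻¹' O) := e.isOpen_inter_preimage hOo
  have h0S : (0 : ↥(LinearMap.range ad) × ↥(LinearMap.ker ad)) ∈ e.source ∩ e ⁻¹' O := ⟨h0, by rw [Set.mem_preimage, he0]; exact hAO⟩
  obtain ⟨r, hr, hrS⟩ := Metric.nhds_basis_closedBall.mem_iff.1 (hSo.mem_nhds h0S)
  have hrsrc : closedBall (0 : ↥(LinearMap.range ad) × ↥(LinearMap.ker ad)) r ⊆ e.source := fun q hq => (hrS hq).1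
  have hrO : ∀ q ∈ closedBall (0 : ↥(LinearMap.range ad) × ↥(LinearMap.ker ad)) r, e q ∈ O := fun q hq => (hrS hq).2
  have hnorm : ∀ q : ↥(LinearMap.range ad) × ↥(LinearMap.ker ad), ‖q‖ = max ‖q.1‖ ‖q.2‖ := fun q => Prod.norm_def q
  have hmemr : ∀ (X : ↥(LinearMap.range ad)) (Y : ↥(LinearMap.ker ad)), ‖X‖ ≤ r → ‖Y‖ ≤ r →
      ((X, Y) : ↥(LinearMap.range ad) × ↥(LinearMap.ker ad)) ∈ closedBall (0 : ↥(LinearMap.range ad) × ↥(LinearMap.ker ad)) r := by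
    intro X Y hX hY
    rw [mem_closedBall_zero_iff, hnorm]
    exact max_le hX hY
  -- ### §4 the slice neighbourhood `V₀` of `A`
  set V₀ : Set (Matrix n n ℂ) := e.target ∩ e.symm ⁻¹' ball (0 : ↥(LinearMap.range ad) × ↥(LinearMap.ker ad)) (r / 2) with hV₀def
  have hV₀o : IsOpen V₀ := e.isOpen_inter_preimage_symm isOpen_ball
  have hAV₀ : A ∈ V₀ := ⟨hγt, by rw [Set.mem_preimage, hsymm]; exact mem_ball_self (by positivity)⟩
  have hV₀O : V₀ ⊆ O := by
    intro W hW
    have hq : e.symm W ∈ closedBall (0 : ↥(LinearMap.range ad) × ↥(LinearMap.ker ad)) r :=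
      closedBall_subset_closedBall (by linarith) (ball_subset_closedBall hW.2)
    have h := hrO _ hq
    rwa [e.right_inv hW.1] at h
  -- the slice reading of a centraliser element in `V₀`
  have hV0 : ∀ z : ↥U, z ∈ Z → ((z : GL n ℂ) : Matrix n n ℂ) ∈ V₀ →
      (e.symm ((z : GL n ℂ) : Matrix n n ℂ)).1 = 0 ∧ ‖(e.symm ((z : GL n ℂ) : Matrix n n ℂ)).2‖ < r / 2 ∧
      (((0 : ↥(LinearMap.range ad)), (e.symm ((z : GL n ℂ) : Matrix n n ℂ)).2) : ↥(LinearMap.range ad) × ↥(LinearMap.ker ad)) ∈ e.source ∧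
      e ((0 : ↥(LinearMap.range ad)), (e.symm ((z : GL n ℂ) : Matrix n n ℂ)).2) = ((z : GL n ℂ) : Matrix n n ℂ) ∧
      ((z : GL n ℂ) : Matrix n n ℂ) = A * cayley ((e.symm ((z : GL n ℂ) : Matrix n n ℂ)).2 : Matrix n n ℂ) := by
    intro z hzZ hzV
    set q := e.symm ((z : GL n ℂ) : Matrix n n ℂ) with hqdef
    have hqball : q ∈ ball (0 : ↥(LinearMap.range ad) × ↥(LinearMap.ker ad)) (r / 2) := hzV.2
    have hqn : ‖q‖ < r / 2 := mem_ball_zero_iff.1 hqball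
    have hq1 : ‖q.1‖ < r / 2 := lt_of_le_of_lt (by rw [hnorm]; exact le_max_left _ _) hqn
    have hq2 : ‖q.2‖ < r / 2 := lt_of_le_of_lt (by rw [hnorm]; exact le_max_right _ _) hqn
    have hqsrc : q ∈ e.source := e.map_target hzV.1
    have heq : e q = ((z : GL n ℂ) : Matrix n n ℂ) := e.right_inv hzV.1
    have h0Y : (((0 : ↥(LinearMap.range ad)), q.2) : ↥(LinearMap.range ad) × ↥(LinearMap.ker ad)) ∈ closedBall (0 : _) r :=
      hmemr 0 q.2 (by rw [norm_zero]; exact hr.le) (by linarith)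
    have h0Ysrc := hrsrc h0Y
    -- units
    obtain ⟨u1, u1', u2, u2'⟩ := hunits q hqsrc
    -- `z₀ := e(0, Y) = A c(Y)` is a slice point in `V`, commuting with `A`
    have hz₀ : e ((0 : ↥(LinearMap.range ad)), q.2) = A * cayley (q.2 : Matrix n n ℂ) := by
      rw [he]; simp only [ZeroMemClass.coe_zero, cayley_zero, Ring.inverse_one, mul_one, one_mul]
    have hYcomm : Commute A (q.2 : Matrix n n ℂ) := by
      have h := q.2.2; rw [LinearMap.mem_ker, had_apply, sub_eq_zero] at h; exact h
    have hcYcomm : Commute A (cayley (q.2 : Matrix n n ℂ)) := commute_cayley hYcomm u2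
    have hz₀comm : Commute (A * cayley (q.2 : Matrix n n ℂ)) A := (Commute.refl A).mul_left hcYcomm.symm
    have hz₀V : A * cayley (q.2 : Matrix n n ℂ) ∈ V := by rw [← hz₀]; exact (hrO _ h0Y).2
    have hzV : ((z : GL n ℂ) : Matrix n n ℂ) ∈ V := (hV₀O hzV).2
    have hzcomm : Commute ((z : GL n ℂ) : Matrix n n ℂ) A := (hZ z).1 hzZ
    -- `c(X) · z₀ = z · c(X)`, so `c(X)` commutes with `A` by Weyl separation, hence `X ∈ 𝔠 ∩ 𝔪 = 0`
    have hzform : ((z : GL n ℂ) : Matrix n n ℂ) = cayley (q.1 : Matrix n n ℂ) * (A * cayley (q.2 : Matrix n n ℂ)) * Ring.inverse (cayley (q.1 : Matrix n n ℂ)) := by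
      rw [← heq, he]
    have hcXu : IsUnit (cayley (q.1 : Matrix n n ℂ)) := isUnit_cayley u1 u1'
    have hinter : cayley (q.1 : Matrix n n ℂ) * (A * cayley (q.2 : Matrix n n ℂ)) = ((z : GL n ℂ) : Matrix n n ℂ) * cayley (q.1 : Matrix n n ℂ) := by
      rw [hzform, mul_assoc (cayley (q.1 : Matrix n n ℂ) * (A * cayley (q.2 : Matrix n n ℂ))), Ring.inverse_mul_cancel _ hcXu, mul_one]
    have hcXcomm : Commute (cayley (q.1 : Matrix n n ℂ)) A :=
      hVW _ hz₀V _ hzV hz₀comm hzcomm _ hinter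
    have hXcomm : Commute A (q.1 : Matrix n n ℂ) := by
      have h := commute_cayley hcXcomm.symm (isUnit_one_add_cayley u1)
      rwa [cayley_cayley u1] at h
    have hX0 : (q.1 : Matrix n n ℂ) = 0 := by
      have hk : (q.1 : Matrix n n ℂ) ∈ LinearMap.ker ad := by rw [LinearMap.mem_ker, had_apply, sub_eq_zero]; exact hXcomm.eq
      have hmem : (q.1 : Matrix n n ℂ) ∈ LinearMap.ker ad ⊓ LinearMap.range ad := Submodule.mem_inf.mpr ⟨hk, q.1.2⟩
      rwa [hcK.inf_eq_bot, Submodule.mem_bot] at hmem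
    have hq10 : q.1 = 0 := Subtype.ext hX0
    have hq0Y : q = ((0 : ↥(LinearMap.range ad)), q.2) := Prod.ext hq10 rfl
    refine ⟨hq10, hq2, h0Ysrc, by rw [← hq0Y]; exact heq, ?_⟩
    rw [← hz₀, ← hq0Y, heq]
  -- ### the data depending on `Φ`
  refine ⟨V₀, hV₀o.mem_nhds hAV₀, fun Φ hΦ hΦV => ?_⟩
  -- ### §5 membership of the Cayley conjugator and Weyl separation in group form
  have hskew : ∀ q ∈ e.source, (∃ t : ↥U, ((t : GL n ℂ) : Matrix n n ℂ) = e q) →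
      J⁻¹ * ((q.1 : Matrix n n ℂ).map σ)ᵀ * J = -(q.1 : Matrix n n ℂ) ∧ J⁻¹ * ((q.2 : Matrix n n ℂ).map σ)ᵀ * J = -(q.2 : Matrix n n ℂ) := by
    rintro q hq ⟨t, ht⟩
    exact (hI hq).1 ⟨(t : GL n ℂ), t.2, ht⟩
  have hcU : ∀ q ∈ e.source, (∃ t : ↥U, ((t : GL n ℂ) : Matrix n n ℂ) = e q) → ∃ cX : ↥U, ((cX : GL n ℂ) : Matrix n n ℂ) = cayley (q.1 : Matrix n n ℂ) := by
    intro q hq ht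
    obtain ⟨u1, u1', -, -⟩ := hunits q hq
    obtain ⟨gX, hgX, hgXe⟩ := Literature.LinearAlgebra.Matrix.cayley_mem_unitaryGroupOfForm σ hJ (hskew q hq ht).1 u1 u1'
    exact ⟨⟨gX, hgX⟩, hgXe⟩
  -- (SEP): if `x ζ x⁻¹ = e q` with `ζ ∈ Z ∩ V` and `q` in the box, then `c(q.1)⁻¹ · x ∈ Z`
  have hsep : ∀ (x ζ : ↥U), ζ ∈ Z → ((ζ : GL n ℂ) : Matrix n n ℂ) ∈ V →
      ∀ q ∈ closedBall (0 : ↥(LinearMap.range ad) × ↥(LinearMap.ker ad)) r,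
        (((x * ζ * x⁻¹ : ↥U) : GL n ℂ) : Matrix n n ℂ) = e q →
        ∀ cX : ↥U, ((cX : GL n ℂ) : Matrix n n ℂ) = cayley (q.1 : Matrix n n ℂ) → cX⁻¹ * x ∈ Z := by
    intro x ζ hζZ hζV q hq hxq cX hcX
    have hqsrc := hrsrc hq
    obtain ⟨u1, u1', u2, -⟩ := hunits q hqsrc
    have hcXu : IsUnit (cayley (q.1 : Matrix n n ℂ)) := isUnit_cayley u1 u1'
    -- the slice point `z₂ = A c(q.2)`
    have hYcomm : Commute A (q.2 : Matrix n n ℂ) := by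
      have h := q.2.2; rw [LinearMap.mem_ker, had_apply, sub_eq_zero] at h; exact h
    have hz₂comm : Commute (A * cayley (q.2 : Matrix n n ℂ)) A := (Commute.refl A).mul_left (commute_cayley hYcomm u2).symm
    have h0Y : (((0 : ↥(LinearMap.range ad)), q.2) : ↥(LinearMap.range ad) × ↥(LinearMap.ker ad)) ∈ closedBall (0 : _) r := by
      refine hmemr 0 q.2 (by rw [norm_zero]; exact hr.le) ?_
      have h := mem_closedBall_zero_iff.1 hq; rw [hnorm] at h; exact le_of_max_le_right h
    have hz₂V : A * cayley (q.2 : Matrix n n ℂ) ∈ V := by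
      have h := (hrO _ h0Y).2
      rw [he] at h; simpa only [ZeroMemClass.coe_zero, cayley_zero, Ring.inverse_one, mul_one, one_mul] using h
    -- the intertwining relation `(c⁻¹ x) ζ = z₂ (c⁻¹ x)`
    have hy : (((cX⁻¹ * x : ↥U) : GL n ℂ) : Matrix n n ℂ) * ((ζ : GL n ℂ) : Matrix n n ℂ) =
        (A * cayley (q.2 : Matrix n n ℂ)) * (((cX⁻¹ * x : ↥U) : GL n ℂ) : Matrix n n ℂ) := by
      have h1 : (((x * ζ * x⁻¹ : ↥U) : GL n ℂ) : Matrix n n ℂ) * ((x : GL n ℂ) : Matrix n n ℂ) = ((x : GL n ℂ) : Matrix n n ℂ) * ((ζ : GL n ℂ) : Matrix n n ℂ) := by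
        rw [cm, cm, mul_assoc, cim, mul_one]
      have h2 : Ring.inverse (cayley (q.1 : Matrix n n ℂ)) * (((x * ζ * x⁻¹ : ↥U) : GL n ℂ) : Matrix n n ℂ) =
          (A * cayley (q.2 : Matrix n n ℂ)) * Ring.inverse (cayley (q.1 : Matrix n n ℂ)) := by
        rw [hxq, he, ← mul_assoc, ← mul_assoc, Ring.inverse_mul_cancel _ hcXu, one_mul]
      rw [cm, cinv, hcX]
      calc Ring.inverse (cayley (q.1 : Matrix n n ℂ)) * ((x : GL n ℂ) : Matrix n n ℂ) * ((ζ : GL n ℂ) : Matrix n n ℂ)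
          = Ring.inverse (cayley (q.1 : Matrix n n ℂ)) * ((((x * ζ * x⁻¹ : ↥U) : GL n ℂ) : Matrix n n ℂ) * ((x : GL n ℂ) : Matrix n n ℂ)) := by
            rw [h1, mul_assoc]
        _ = (A * cayley (q.2 : Matrix n n ℂ)) * (Ring.inverse (cayley (q.1 : Matrix n n ℂ)) * ((x : GL n ℂ) : Matrix n n ℂ)) := by
            rw [← mul_assoc, h2, mul_assoc]
    exact (hZ _).2 (hVW _ hζV _ hz₂V ((hZ ζ).1 hζZ) hz₂comm _ hy)
  -- uniqueness of the transversal coordinate of a coset `x Z`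
  have huniq : ∀ (x cX₁ cX₂ : ↥U) (X₁ X₂ : ↥(LinearMap.range ad)),
      ((cX₁ : GL n ℂ) : Matrix n n ℂ) = cayley (X₁ : Matrix n n ℂ) → ((cX₂ : GL n ℂ) : Matrix n n ℂ) = cayley (X₂ : Matrix n n ℂ) →
      ((X₁, (0 : ↥(LinearMap.ker ad))) : ↥(LinearMap.range ad) × ↥(LinearMap.ker ad)) ∈ e.source →
      ((X₂, (0 : ↥(LinearMap.ker ad))) : ↥(LinearMap.range ad) × ↥(LinearMap.ker ad)) ∈ e.source →
      cX₁⁻¹ * x ∈ Z → cX₂⁻¹ * x ∈ Z → X₁ = X₂ := by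
    intro x cX₁ cX₂ X₁ X₂ hc₁ hc₂ hs₁ hs₂ hZ₁ hZ₂
    have hv : cX₂⁻¹ * cX₁ ∈ Z := by
      have h := Z.mul_mem hZ₂ (Z.inv_mem hZ₁)
      rwa [mul_inv_rev, inv_inv, mul_assoc, mul_inv_cancel_left] at h
    have hvc : Commute (((cX₂⁻¹ * cX₁ : ↥U) : GL n ℂ) : Matrix n n ℂ) A := (hZ _).1 hv
    have hu₁ : IsUnit (cayley (X₁ : Matrix n n ℂ)) := by rw [← hc₁]; exact Units.isUnit _
    have hu₂ : IsUnit (cayley (X₂ : Matrix n n ℂ)) := by rw [← hc₂]; exact Units.isUnit _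
    have hconj : cayley (X₁ : Matrix n n ℂ) * A * Ring.inverse (cayley (X₁ : Matrix n n ℂ)) =
        cayley (X₂ : Matrix n n ℂ) * A * Ring.inverse (cayley (X₂ : Matrix n n ℂ)) := by
      have h := hvc.eq
      rw [cm, cinv, hc₁, hc₂] at h
      -- `h : c₂⁻¹ c₁ A = A c₂⁻¹ c₁`
      calc cayley (X₁ : Matrix n n ℂ) * A * Ring.inverse (cayley (X₁ : Matrix n n ℂ))
          = cayley (X₂ : Matrix n n ℂ) * (Ring.inverse (cayley (X₂ : Matrix n n ℂ)) * cayley (X₁ : Matrix n n ℂ) * A) * Ring.inverse (cayley (X₁ : Matrix n n ℂ)) := by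
            rw [← mul_assoc, ← mul_assoc, Ring.mul_inverse_cancel _ hu₂, one_mul]
        _ = cayley (X₂ : Matrix n n ℂ) * (A * Ring.inverse (cayley (X₂ : Matrix n n ℂ)) * cayley (X₁ : Matrix n n ℂ)) * Ring.inverse (cayley (X₁ : Matrix n n ℂ)) := by
            rw [h, mul_assoc A]
        _ = cayley (X₂ : Matrix n n ℂ) * A * Ring.inverse (cayley (X₂ : Matrix n n ℂ)) := by
            rw [mul_assoc, mul_assoc, mul_assoc, Ring.mul_inverse_cancel _ hu₁, mul_one, ← mul_assoc]
    have he₁ : e (X₁, 0) = cayley (X₁ : Matrix n n ℂ) * A * Ring.inverse (cayley (X₁ : Matrix n n ℂ)) := by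
      rw [he]; simp only [ZeroMemClass.coe_zero, cayley_zero, mul_one]
    have he₂ : e (X₂, 0) = cayley (X₂ : Matrix n n ℂ) * A * Ring.inverse (cayley (X₂ : Matrix n n ℂ)) := by
      rw [he]; simp only [ZeroMemClass.coe_zero, cayley_zero, mul_one]
    have hinj := e.injOn hs₁ hs₂ (by rw [he₁, he₂, hconj])
    exact (Prod.ext_iff.1 hinj).1
  -- ### §6 the bump functions and the generator
  let aB : ContDiffBump (0 : ↥(LinearMap.range ad)) := ⟨r / 4, r / 2, by positivity, by linarith [hr]⟩
  have hr34 : r / 2 < 3 * r / 4 := by linarith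
  let bB : ContDiffBump (0 : ↥(LinearMap.ker ad)) := ⟨r / 2, 3 * r / 4, by positivity, hr34⟩
  have haB1 : ∀ X : ↥(LinearMap.range ad), aB X ≠ 0 → ‖X‖ < r / 2 := fun X hX => by
    have h : X ∈ Function.support (aB : ↥(LinearMap.range ad) → ℝ) := hX
    rw [aB.support_eq] at h; simpa using h
  have hbB1 : ∀ Y : ↥(LinearMap.ker ad), bB Y ≠ 0 → ‖Y‖ < 3 * r / 4 := fun Y hY => by
    have h : Y ∈ Function.support (bB : ↥(LinearMap.ker ad) → ℝ) := hY
    rw [bB.support_eq] at h; simpa using h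
  have hbB2 : ∀ Y : ↥(LinearMap.ker ad), ‖Y‖ < r / 2 → bB Y = 1 := fun Y hY =>
    bB.one_of_mem_closedBall (by rw [mem_closedBall, dist_zero_right]; exact hY.le)
  have haB0 : aB 0 = 1 := aB.one_of_mem_closedBall (mem_closedBall_self (by positivity))
  have hbB0 : bB 0 = 1 := bB.one_of_mem_closedBall (mem_closedBall_self (by positivity))
  set Ψ : ↥(LinearMap.ker ad) → ℂ := fun Y => ((bB Y : ℝ) : ℂ) * Φ (e ((0 : ↥(LinearMap.range ad)), Y)) with hΨ
  set H : Matrix n n ℂ → ℂ := fun W => ((aB (e.symm W).1 : ℝ) : ℂ) * Ψ (e.symm W).2 with hH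
  set G : Matrix n n ℂ → ℂ := fun W => ((aB (e.symm W).1 : ℝ) : ℂ) * ((bB (e.symm W).2 : ℝ) : ℂ) with hG
  set C : Set (Matrix n n ℂ) := e '' closedBall (0 : ↥(LinearMap.range ad) × ↥(LinearMap.ker ad)) (3 * r / 4) with hCdef
  have h34 : closedBall (0 : ↥(LinearMap.range ad) × ↥(LinearMap.ker ad)) (3 * r / 4) ⊆ closedBall 0 r := closedBall_subset_closedBall (by linarith)
  have hCcpt : IsCompact C := (isCompact_closedBall _ _).image_of_continuousOn (e.continuousOn.mono (h34.trans hrsrc))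
  have hCu : C ⊆ u := by
    rintro _ ⟨q, hq, rfl⟩; exact (hrO q (h34 hq)).1.1
  have hCU₀ : C ⊆ U₀ := by
    rintro _ ⟨q, hq, rfl⟩; exact interior_subset (hrO q (h34 hq)).1.2
  -- smoothness of `Ψ`
  have hΨs : ContDiff ℝ ∞ Ψ := by
    have hopen : IsOpen {Y : ↥(LinearMap.ker ad) | (((0 : ↥(LinearMap.range ad)), Y) : ↥(LinearMap.range ad) × ↥(LinearMap.ker ad)) ∈ e.source} :=
      e.open_source.preimage (Continuous.prodMk_right 0)
    refine contDiff_mul_of_tsupport_subset hopen (Complex.ofRealCLM.contDiff.comp bB.contDiff) ?_ ?_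
    · rw [tsupport, show Function.support (fun Y : ↥(LinearMap.ker ad) => ((bB Y : ℝ) : ℂ)) = Function.support (bB : ↥(LinearMap.ker ad) → ℝ) by
        ext Y; simp, ← tsupport, bB.tsupport_eq]
      intro Y hY
      exact hrsrc (hmemr 0 Y (by rw [norm_zero]; exact hr.le) ((mem_closedBall_zero_iff.1 (by simpa using hY)).trans (by show (3 : ℝ) * r / 4 ≤ r; linarith)))
    · intro Y hY
      obtain ⟨u1, u1', u2, -⟩ := hunits _ hY
      have h1 : ContDiffAt ℝ ∞ (e : ↥(LinearMap.range ad) × ↥(LinearMap.ker ad) → Matrix n n ℂ) (((0 : ↥(LinearMap.range ad)), Y)) := by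
        rw [hF]; exact contDiffAt_cayleyConj A _ _ u1 u1' u2
      have h2 : ContDiff ℝ ∞ fun Y' : ↥(LinearMap.ker ad) => (((0 : ↥(LinearMap.range ad)), Y') : ↥(LinearMap.range ad) × ↥(LinearMap.ker ad)) :=
        contDiff_prodMk_right 0
      exact ((hΦ.contDiffAt.comp _ h1).comp Y h2.contDiffAt).contDiffWithinAt
  -- smoothness of `H`, `G` on `u`
  have hproj₁ : ContDiff ℝ ∞ fun q : ↥(LinearMap.range ad) × ↥(LinearMap.ker ad) => ((aB q.1 : ℝ) : ℂ) :=
    Complex.ofRealCLM.contDiff.comp (aB.contDiff.comp contDiff_fst)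
  have hproj₂ : ContDiff ℝ ∞ fun q : ↥(LinearMap.range ad) × ↥(LinearMap.ker ad) => ((bB q.2 : ℝ) : ℂ) :=
    Complex.ofRealCLM.contDiff.comp (bB.contDiff.comp contDiff_snd)
  have hHu : ContDiffOn ℝ ∞ H u := fun W hW =>
    ((hproj₁.contDiffAt.comp W (hsm.contDiffAt (huo.mem_nhds hW))).mul
      ((hΨs.comp contDiff_snd).contDiffAt.comp W (hsm.contDiffAt (huo.mem_nhds hW)))).contDiffWithinAt
  have hGu : ContDiffOn ℝ ∞ G u := fun W hW =>
    ((hproj₁.contDiffAt.comp W (hsm.contDiffAt (huo.mem_nhds hW))).mul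
      (hproj₂.contDiffAt.comp W (hsm.contDiffAt (huo.mem_nhds hW)))).contDiffWithinAt
  -- support control: a point of `u` where the bumps do not vanish lies in `C`
  have hbox : ∀ W ∈ u, aB (e.symm W).1 ≠ 0 → bB (e.symm W).2 ≠ 0 →
      e.symm W ∈ closedBall (0 : ↥(LinearMap.range ad) × ↥(LinearMap.ker ad)) (3 * r / 4) ∧ W ∈ C := by
    intro W hW ha hb
    have h1 := haB1 _ ha
    have h2 := hbB1 _ hb
    have hq : e.symm W ∈ closedBall (0 : ↥(LinearMap.range ad) × ↥(LinearMap.ker ad)) (3 * r / 4) := by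
      rw [mem_closedBall_zero_iff, hnorm]; exact max_le (by linarith) h2.le
    exact ⟨hq, ⟨e.symm W, hq, e.right_inv (hut hW)⟩⟩
  have hHC : ∀ W ∈ u, H W ≠ 0 → W ∈ C := by
    intro W hW hHW
    have ha : aB (e.symm W).1 ≠ 0 := fun h => hHW (by simp only [hH, h, Complex.ofReal_zero, zero_mul])
    have hb : bB (e.symm W).2 ≠ 0 := fun h => hHW (by simp only [hH, hΨ, h, Complex.ofReal_zero, zero_mul, mul_zero])
    exact (hbox W hW ha hb).2
  have hGC : ∀ W ∈ u, G W ≠ 0 → W ∈ C := by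
    intro W hW hGW
    have ha : aB (e.symm W).1 ≠ 0 := fun h => hGW (by simp only [hG, h, Complex.ofReal_zero, zero_mul])
    have hb : bB (e.symm W).2 ≠ 0 := fun h => hGW (by simp only [hG, h, Complex.ofReal_zero, mul_zero])
    exact (hbox W hW ha hb).2
  obtain ⟨hfs, hfC⟩ := contDiff_indicator_of_forall_mem huo hHu hCcpt.isClosed hCu hHC
  obtain ⟨hgs, hgC⟩ := contDiff_indicator_of_forall_mem huo hGu hCcpt.isClosed hCu hGC
  have hfcs : HasCompactSupport (u.indicator H) := HasCompactSupport.intro hCcpt fun W hW => by by_contra h; exact hW (hfC W h)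
  have hgcs : HasCompactSupport (u.indicator G) := HasCompactSupport.intro hCcpt fun W hW => by by_contra h; exact hW (hgC W h)
  have htsf : tsupport (u.indicator H) ⊆ U₀ := (closure_minimal (fun W hW => hfC W hW) hCcpt.isClosed).trans hCU₀
  have htsg : tsupport (u.indicator G) ⊆ U₀ := (closure_minimal (fun W hW => hgC W hW) hCcpt.isClosed).trans hCU₀
  refine ⟨u.indicator H, u.indicator G, hfs, hfcs, htsf, hgs, hgcs, htsg, fun W => ?_, ?_, ?_⟩
  · by_cases hW : W ∈ u
    · rw [Set.indicator_of_mem hW]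
      show 0 ≤ (((aB (e.symm W).1 : ℝ) : ℂ) * ((bB (e.symm W).2 : ℝ) : ℂ)).re ∧ (((aB (e.symm W).1 : ℝ) : ℂ) * ((bB (e.symm W).2 : ℝ) : ℂ)).im = 0
      rw [← Complex.ofReal_mul, Complex.ofReal_re, Complex.ofReal_im]
      exact ⟨mul_nonneg aB.nonneg bB.nonneg, rfl⟩
    · rw [Set.indicator_of_notMem hW]; simp
  · rw [Set.indicator_of_mem hγu]
    show ((aB (e.symm A).1 : ℝ) : ℂ) * ((bB (e.symm A).2 : ℝ) : ℂ) = 1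
    rw [hsymm, Prod.fst_zero, Prod.snd_zero, haB0, hbB0, Complex.ofReal_one, mul_one]
  -- ### §7 the fibration identity
  intro γ' hγ'Z hγ'V x
  obtain ⟨hγ'1, hγ'2, hγ'src, hγ'e, hγ'c⟩ := hV0 γ' hγ'Z hγ'V
  have hγ'VV : ((γ' : GL n ℂ) : Matrix n n ℂ) ∈ V := (hV₀O hγ'V).2
  -- the value of `g` at `x γ x⁻¹` and of `f` at `x η x⁻¹` once `x = cX · w` with `w ∈ Z`
  have hcore : ∀ (X₁ : ↥(LinearMap.range ad)) (cX : ↥U), ‖X₁‖ < r / 2 → ((cX : GL n ℂ) : Matrix n n ℂ) = cayley (X₁ : Matrix n n ℂ) → cX⁻¹ * x ∈ Z →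
      u.indicator G (((x * γU * x⁻¹ : ↥U) : GL n ℂ) : Matrix n n ℂ) = ((aB X₁ : ℝ) : ℂ) ∧
      ∀ ℓ : ↥U, ℓ ∈ Z →
        u.indicator H (((x * (ℓ * γ' * ℓ⁻¹) * x⁻¹ : ↥U) : GL n ℂ) : Matrix n n ℂ) =
          ((aB X₁ : ℝ) : ℂ) * Φ ((((cX⁻¹ * x) * (ℓ * γ' * ℓ⁻¹) * (cX⁻¹ * x)⁻¹ : ↥U) : GL n ℂ) : Matrix n n ℂ) := by
    intro X₁ cX hX₁ hcX hwZ
    have hX₁r : ((X₁, (0 : ↥(LinearMap.ker ad))) : ↥(LinearMap.range ad) × ↥(LinearMap.ker ad)) ∈ closedBall (0 : _) r :=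
      hmemr X₁ 0 (by linarith) (by rw [norm_zero]; exact hr.le)
    have hcXu : IsUnit (cayley (X₁ : Matrix n n ℂ)) := by rw [← hcX]; exact Units.isUnit _
    obtain ⟨w, hwdef⟩ : ∃ w : ↥U, cX⁻¹ * x = w := ⟨_, rfl⟩
    have hwZ' : w ∈ Z := by rw [← hwdef]; exact hwZ
    rw [hwdef]
    have hxw : x = cX * w := by rw [← hwdef, mul_inv_cancel_left]
    -- conjugates through `cX`
    have hconj : ∀ η : ↥U, (((x * η * x⁻¹ : ↥U) : GL n ℂ) : Matrix n n ℂ) =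
        cayley (X₁ : Matrix n n ℂ) * (((w * η * w⁻¹ : ↥U) : GL n ℂ) : Matrix n n ℂ) * Ring.inverse (cayley (X₁ : Matrix n n ℂ)) := by
      intro η
      have hgrp : x * η * x⁻¹ = cX * (w * η * w⁻¹) * cX⁻¹ := by rw [hxw]; group
      rw [hgrp, cm, cm, cinv, hcX]
    have hwγ : w * γU * w⁻¹ = γU := by
      have h := (Subgroup.mem_centralizer_iff.1 hwZ') γU (Set.mem_singleton γU)
      rw [mul_inv_eq_iff_eq_mul, h]
    -- the `g`-value
    have hgval : u.indicator G (((x * γU * x⁻¹ : ↥U) : GL n ℂ) : Matrix n n ℂ) = ((aB X₁ : ℝ) : ℂ) := by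
      have hW : (((x * γU * x⁻¹ : ↥U) : GL n ℂ) : Matrix n n ℂ) = e (X₁, 0) := by
        rw [hconj, hwγ]
        show cayley (X₁ : Matrix n n ℂ) * A * Ring.inverse (cayley (X₁ : Matrix n n ℂ)) = e (X₁, 0)
        rw [he]; simp only [ZeroMemClass.coe_zero, cayley_zero, mul_one]
      have hWu : e (X₁, 0) ∈ u := (hrO _ hX₁r).1.1
      rw [hW, Set.indicator_of_mem hWu]
      show ((aB (e.symm (e (X₁, 0))).1 : ℝ) : ℂ) * ((bB (e.symm (e (X₁, 0))).2 : ℝ) : ℂ) = ((aB X₁ : ℝ) : ℂ)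
      rw [e.left_inv (hrsrc hX₁r)]
      show ((aB X₁ : ℝ) : ℂ) * ((bB 0 : ℝ) : ℂ) = ((aB X₁ : ℝ) : ℂ)
      rw [hbB0, Complex.ofReal_one, mul_one]
    refine ⟨hgval, fun ℓ hℓ => ?_⟩
    obtain ⟨η, hηdef⟩ : ∃ η : ↥U, ℓ * γ' * ℓ⁻¹ = η := ⟨_, rfl⟩
    have hηZ : η ∈ Z := by rw [← hηdef]; exact Z.mul_mem (Z.mul_mem hℓ hγ'Z) (Z.inv_mem hℓ)
    rw [hηdef]
    obtain ⟨η', hη'def⟩ : ∃ η' : ↥U, w * η * w⁻¹ = η' := ⟨_, rfl⟩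
    have hη'Z : η' ∈ Z := by rw [← hη'def]; exact Z.mul_mem (Z.mul_mem hwZ' hηZ) (Z.inv_mem hwZ')
    rw [hη'def]
    have hW : (((x * η * x⁻¹ : ↥U) : GL n ℂ) : Matrix n n ℂ) =
        cayley (X₁ : Matrix n n ℂ) * ((η' : GL n ℂ) : Matrix n n ℂ) * Ring.inverse (cayley (X₁ : Matrix n n ℂ)) := by rw [← hη'def]; exact hconj η
    by_cases hΦη : Φ ((η' : GL n ℂ) : Matrix n n ℂ) = 0
    · -- RHS vanishes; so does LHS, by Weyl separation
      rw [hΦη, mul_zero]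
      by_contra hfW
      have hWu : (((x * η * x⁻¹ : ↥U) : GL n ℂ) : Matrix n n ℂ) ∈ u := by
        by_contra h; exact hfW (Set.indicator_of_notMem h _)
      rw [Set.indicator_of_mem hWu] at hfW
      have ha : aB (e.symm (((x * η * x⁻¹ : ↥U) : GL n ℂ) : Matrix n n ℂ)).1 ≠ 0 := fun h => hfW (by simp only [hH, h, Complex.ofReal_zero, zero_mul])
      have hb : bB (e.symm (((x * η * x⁻¹ : ↥U) : GL n ℂ) : Matrix n n ℂ)).2 ≠ 0 := fun h =>
        hfW (by simp only [hH, hΨ, h, Complex.ofReal_zero, zero_mul, mul_zero])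
      obtain ⟨hq₂, -⟩ := hbox _ hWu ha hb
      obtain ⟨q₂, hq₂def⟩ : ∃ q₂ : ↥(LinearMap.range ad) × ↥(LinearMap.ker ad), e.symm (((x * η * x⁻¹ : ↥U) : GL n ℂ) : Matrix n n ℂ) = q₂ := ⟨_, rfl⟩
      rw [hq₂def] at hq₂ ha hb
      have hq₂r : q₂ ∈ closedBall (0 : ↥(LinearMap.range ad) × ↥(LinearMap.ker ad)) r := h34 hq₂
      have hWe : (((x * η * x⁻¹ : ↥U) : GL n ℂ) : Matrix n n ℂ) = e q₂ := by rw [← hq₂def]; exact (e.right_inv (hut hWu)).symm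
      -- `x (ℓ γ' ℓ⁻¹) x⁻¹ = (x ℓ) γ' (x ℓ)⁻¹`
      have hWe' : ((((x * ℓ) * γ' * (x * ℓ)⁻¹ : ↥U) : GL n ℂ) : Matrix n n ℂ) = e q₂ := by
        rw [← hWe, ← hηdef]; congr 2; group
      obtain ⟨cX₂, hcX₂⟩ := hcU q₂ (hrsrc hq₂r) ⟨_, hWe'⟩
      have hZ₂ : cX₂⁻¹ * (x * ℓ) ∈ Z := hsep (x * ℓ) γ' hγ'Z hγ'VV q₂ hq₂r hWe' cX₂ hcX₂
      have hZ₂' : cX₂⁻¹ * x ∈ Z := by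
        have h := Z.mul_mem hZ₂ (Z.inv_mem hℓ)
        rwa [← mul_assoc, mul_assoc (cX₂⁻¹ * x), mul_inv_cancel, mul_one] at h
      -- so `q₂.1 = X₁`
      have hq₂1n : ‖q₂.1‖ < r / 2 := haB1 _ ha
      have hX₂src : ((q₂.1, (0 : ↥(LinearMap.ker ad))) : ↥(LinearMap.range ad) × ↥(LinearMap.ker ad)) ∈ e.source :=
        hrsrc (hmemr q₂.1 0 (by linarith) (by rw [norm_zero]; exact hr.le))
      have hXeq : X₁ = q₂.1 := huniq x cX cX₂ X₁ q₂.1 hcX hcX₂ (hrsrc hX₁r) hX₂src hwZ hZ₂'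
      -- and `η' = A c(q₂.2) = e (0, q₂.2)`
      obtain ⟨-, -, u2, -⟩ := hunits q₂ (hrsrc hq₂r)
      have hη'eq : ((η' : GL n ℂ) : Matrix n n ℂ) = A * cayley (q₂.2 : Matrix n n ℂ) := by
        have h := hW
        rw [hWe, he, ← hXeq] at h
        -- `c (A c(Y₂)) c⁻¹ = c η' c⁻¹` with `c = c(X₁)` a unit: cancel
        have h3 := (hcXu.ringInverse.mul_left_inj).1 h
        exact ((hcXu.mul_right_inj).1 h3).symm
      have h0Y₂ : (((0 : ↥(LinearMap.range ad)), q₂.2) : ↥(LinearMap.range ad) × ↥(LinearMap.ker ad)) ∈ e.source :=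
        hrsrc (hmemr 0 q₂.2 (by rw [norm_zero]; exact hr.le) (by
          have h := mem_closedBall_zero_iff.1 hq₂r; rw [hnorm] at h; exact le_of_max_le_right h))
      have hη'e : e ((0 : ↥(LinearMap.range ad)), q₂.2) = ((η' : GL n ℂ) : Matrix n n ℂ) := by
        rw [hη'eq, he]; simp only [ZeroMemClass.coe_zero, cayley_zero, Ring.inverse_one, mul_one, one_mul]
      -- the value of `H`
      apply hfW
      show ((aB (e.symm (((x * η * x⁻¹ : ↥U) : GL n ℂ) : Matrix n n ℂ)).1 : ℝ) : ℂ) *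
          (((bB (e.symm (((x * η * x⁻¹ : ↥U) : GL n ℂ) : Matrix n n ℂ)).2 : ℝ) : ℂ) *
            Φ (e ((0 : ↥(LinearMap.range ad)), (e.symm (((x * η * x⁻¹ : ↥U) : GL n ℂ) : Matrix n n ℂ)).2))) = 0
      rw [hq₂def, hη'e, hΦη, mul_zero, mul_zero]
    · -- `Φ(η') ≠ 0`: `η' ∈ V₀` is a slice point `e(0, Y')` with `‖Y'‖ < r/2`, and `x η x⁻¹ = e(X₁, Y')`
      have hη'V : ((η' : GL n ℂ) : Matrix n n ℂ) ∈ V₀ := hΦV η' hη'Z hΦη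
      obtain ⟨-, hY'n, hY'src, hY'e, hY'c⟩ := hV0 η' hη'Z hη'V
      obtain ⟨Y', hY'def⟩ : ∃ Y' : ↥(LinearMap.ker ad), (e.symm ((η' : GL n ℂ) : Matrix n n ℂ)).2 = Y' := ⟨_, rfl⟩
      rw [hY'def] at hY'n hY'src hY'e hY'c
      have hq₁r : ((X₁, Y') : ↥(LinearMap.range ad) × ↥(LinearMap.ker ad)) ∈ closedBall (0 : _) r := hmemr X₁ Y' (by linarith) (by linarith)
      have hWe : (((x * η * x⁻¹ : ↥U) : GL n ℂ) : Matrix n n ℂ) = e (X₁, Y') := by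
        rw [hW, hY'c, he]
      have hWu : e (X₁, Y') ∈ u := (hrO _ hq₁r).1.1
      rw [hWe, Set.indicator_of_mem hWu]
      show ((aB (e.symm (e (X₁, Y'))).1 : ℝ) : ℂ) * (((bB (e.symm (e (X₁, Y'))).2 : ℝ) : ℂ) * Φ (e ((0 : ↥(LinearMap.range ad)), (e.symm (e (X₁, Y'))).2))) =
        ((aB X₁ : ℝ) : ℂ) * Φ ((η' : GL n ℂ) : Matrix n n ℂ)
      rw [e.left_inv (hrsrc hq₁r)]
      show ((aB X₁ : ℝ) : ℂ) * (((bB Y' : ℝ) : ℂ) * Φ (e ((0 : ↥(LinearMap.range ad)), Y'))) = ((aB X₁ : ℝ) : ℂ) * Φ ((η' : GL n ℂ) : Matrix n n ℂ)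
      rw [hbB2 Y' hY'n, hY'e, Complex.ofReal_one, one_mul]
  -- ### §8 conclusion: split on whether `x ∈ c(X₁) · Z` for a transversal `X₁` of the box
  by_cases hx : ∃ (X₁ : ↥(LinearMap.range ad)) (cX : ↥U), ‖X₁‖ < r / 2 ∧ ((cX : GL n ℂ) : Matrix n n ℂ) = cayley (X₁ : Matrix n n ℂ) ∧ cX⁻¹ * x ∈ Z
  · obtain ⟨X₁, cX, hX₁, hcX, hwZ⟩ := hx
    obtain ⟨hgval, hfval⟩ := hcore X₁ cX hX₁ hcX hwZ
    exact ⟨cX⁻¹ * x, hwZ, fun ℓ hℓ => by rw [hfval ℓ hℓ, hgval]⟩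
  · -- no such decomposition: both sides vanish
    refine ⟨1, Z.one_mem, fun ℓ hℓ => ?_⟩
    -- `g (x γ x⁻¹) = 0`
    have hg0 : u.indicator G (((x * γU * x⁻¹ : ↥U) : GL n ℂ) : Matrix n n ℂ) = 0 := by
      by_contra hgW
      have hWu : (((x * γU * x⁻¹ : ↥U) : GL n ℂ) : Matrix n n ℂ) ∈ u := by
        by_contra h; exact hgW (Set.indicator_of_notMem h _)
      rw [Set.indicator_of_mem hWu] at hgW
      have ha : aB (e.symm (((x * γU * x⁻¹ : ↥U) : GL n ℂ) : Matrix n n ℂ)).1 ≠ 0 := fun h => hgW (by simp only [hG, h, Complex.ofReal_zero, zero_mul])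
      have hb : bB (e.symm (((x * γU * x⁻¹ : ↥U) : GL n ℂ) : Matrix n n ℂ)).2 ≠ 0 := fun h => hgW (by simp only [hG, h, Complex.ofReal_zero, mul_zero])
      obtain ⟨hq₂, -⟩ := hbox _ hWu ha hb
      obtain ⟨q₂, hq₂def⟩ : ∃ q₂ : ↥(LinearMap.range ad) × ↥(LinearMap.ker ad), e.symm (((x * γU * x⁻¹ : ↥U) : GL n ℂ) : Matrix n n ℂ) = q₂ := ⟨_, rfl⟩
      rw [hq₂def] at hq₂ ha hb
      have hq₂r : q₂ ∈ closedBall (0 : ↥(LinearMap.range ad) × ↥(LinearMap.ker ad)) r := h34 hq₂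
      have hWe : (((x * γU * x⁻¹ : ↥U) : GL n ℂ) : Matrix n n ℂ) = e q₂ := by rw [← hq₂def]; exact (e.right_inv (hut hWu)).symm
      obtain ⟨cX₂, hcX₂⟩ := hcU q₂ (hrsrc hq₂r) ⟨_, hWe⟩
      have hZ₂ : cX₂⁻¹ * x ∈ Z := hsep x γU hγUZ (by rw [hγUA]; exact hAV) q₂ hq₂r hWe cX₂ hcX₂
      exact hx ⟨q₂.1, cX₂, haB1 _ ha, hcX₂, hZ₂⟩
    rw [hg0, zero_mul]
    -- `f (x η x⁻¹) = 0`
    by_contra hfW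
    obtain ⟨η, hηdef⟩ : ∃ η : ↥U, ℓ * γ' * ℓ⁻¹ = η := ⟨_, rfl⟩
    rw [hηdef] at hfW
    have hWu : (((x * η * x⁻¹ : ↥U) : GL n ℂ) : Matrix n n ℂ) ∈ u := by
      by_contra h; exact hfW (Set.indicator_of_notMem h _)
    rw [Set.indicator_of_mem hWu] at hfW
    have ha : aB (e.symm (((x * η * x⁻¹ : ↥U) : GL n ℂ) : Matrix n n ℂ)).1 ≠ 0 := fun h => hfW (by simp only [hH, h, Complex.ofReal_zero, zero_mul])
    have hb : bB (e.symm (((x * η * x⁻¹ : ↥U) : GL n ℂ) : Matrix n n ℂ)).2 ≠ 0 := fun h =>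
      hfW (by simp only [hH, hΨ, h, Complex.ofReal_zero, zero_mul, mul_zero])
    obtain ⟨hq₂, -⟩ := hbox _ hWu ha hb
    obtain ⟨q₂, hq₂def⟩ : ∃ q₂ : ↥(LinearMap.range ad) × ↥(LinearMap.ker ad), e.symm (((x * η * x⁻¹ : ↥U) : GL n ℂ) : Matrix n n ℂ) = q₂ := ⟨_, rfl⟩
    rw [hq₂def] at hq₂ ha hb
    have hq₂r : q₂ ∈ closedBall (0 : ↥(LinearMap.range ad) × ↥(LinearMap.ker ad)) r := h34 hq₂
    have hWe : (((x * η * x⁻¹ : ↥U) : GL n ℂ) : Matrix n n ℂ) = e q₂ := by rw [← hq₂def]; exact (e.right_inv (hut hWu)).symm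
    have hWe' : ((((x * ℓ) * γ' * (x * ℓ)⁻¹ : ↥U) : GL n ℂ) : Matrix n n ℂ) = e q₂ := by
      rw [← hWe, ← hηdef]; congr 2; group
    obtain ⟨cX₂, hcX₂⟩ := hcU q₂ (hrsrc hq₂r) ⟨_, hWe'⟩
    have hZ₂ : cX₂⁻¹ * (x * ℓ) ∈ Z := hsep (x * ℓ) γ' hγ'Z hγ'VV q₂ hq₂r hWe' cX₂ hcX₂
    have hZ₂' : cX₂⁻¹ * x ∈ Z := by
      have h := Z.mul_mem hZ₂ (Z.inv_mem hℓ)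
      rwa [← mul_assoc, mul_assoc (cX₂⁻¹ * x), mul_inv_cancel, mul_one] at h
    exact hx ⟨q₂.1, cX₂, haB1 _ ha, hcX₂, hZ₂'⟩

end Generator

end Literature.NumberTheory.Automorphic

end
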